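import Literature.NumberTheory.Sieve.BombieriFriedlanderIwaniecSiegelWalfisz
import Literature.NumberTheory.LFunctions.LiouvilleSumClassicalBound
import HarnessLib

/-!
# Route `ChenParityOracleBLAP` — crux S1 = `HostParityFromBrick` (stmt-Parity-20045): Type-I sums, large moduli — one piece

Support file for the prime half `K1 → K2 → HP1` of S1 (unconditional Type-I input).  For large
moduli `x^{1/3+ε_T} < d ≤ x^{1/2−ε}` the switched Type-I sums `S(d,r) = ∑_{v ≤ V(d,r), v ≡ l(d,r) (2r)} λ(v)`
are controlled by Barban–Davenport–Halberstam for `λ` on initial segments.  This file treats ONE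
short piece `P ⊂ (D', D'+L]` of moduli with a common height `V₀ ≤ V(d,r) ≤ V₀ + H`
(`typeI_piece_le`): the `d ∈ P` with the same class `l(d,r) (mod 2r)` are congruent modulo `r`
(`sum_piece_classes_le`, at most `L/r + 2` of them, `card_le_of_congruent`), the height change
costs `≤ H/(2r) + 2` (`abs_classSum_sub_le`), and Cauchy–Schwarz over classes and over `r ≤ R`
(`sum_abs_classes_le_sqrt`, `sum_weights_sqrt_le`) gives
`≤ (2L√(1+log R) + 4R) (∑_{q ≤ 2R} ∑_l S₀(l;q)²)^{1/2} + #P (H(1+log R) + 2R)`.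

References: E. Bombieri, J. B. Friedlander, H. Iwaniec, Acta Math. 156 (1986), Thm 0
[BombieriFriedlanderIwaniecActa1986]; H. Iwaniec, E. Kowalski, *Analytic Number Theory* (2004),
Thm 17.1 [IwaniecKowalski2004].
-/

namespace Summit.Parity.GeneralizedHardyLittlewood.Theorems

open Finset Real
open ArithmeticFunction (liouville)

/-- A finite set of naturals inside `(a, a+L]` whose elements are pairwise congruent modulo
`r ≥ 1` has at most `L/r + 2` elements. -/
theorem card_le_of_congruent {a L r : ℕ} (hr : 0 < r) {S : Finset ℕ} (hS : S ⊆ Ioc a (a + L))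
    (hmod : ∀ d ∈ S, ∀ d' ∈ S, d % r = d' % r) : #S ≤ L / r + 2 := by
  have hinj : Set.InjOn (fun d => d / r) (S : Set ℕ) := by
    intro d hd d' hd' h
    simp only at h
    calc d = r * (d / r) + d % r := (Nat.div_add_mod d r).symm
      _ = r * (d' / r) + d' % r := by rw [h, hmod d hd d' hd']
      _ = d' := Nat.div_add_mod d' r
  calc #S = #(S.image (fun d => d / r)) := (Finset.card_image_of_injOn hinj).symm
    _ ≤ #(Icc ((a + 1) / r) ((a + L) / r)) := by
        refine Finset.card_le_card fun k hk => ?_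
        rw [Finset.mem_image] at hk
        obtain ⟨d, hd, rfl⟩ := hk
        have := hS hd
        rw [Finset.mem_Ioc] at this
        rw [Finset.mem_Icc]
        exact ⟨Nat.div_le_div_right (by omega), Nat.div_le_div_right this.2⟩
    _ = (a + L) / r + 1 - (a + 1) / r := Nat.card_Icc _ _
    _ ≤ L / r + 2 := by
        have h1 : (a + L) / r ≤ (a + 1 + L) / r := Nat.div_le_div_right (by omega)
        have h2 : (a + 1 + L) / r ≤ (a + 1) / r + L / r + 1 := by
          rw [Nat.add_div hr]; split_ifs <;> omega
        generalize (a + L) / r = p₁ at h1 h2 ⊢; generalize (a + 1) / r = p₂ at h1 h2 ⊢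
        generalize (a + 1 + L) / r = p₃ at h1 h2 ⊢; generalize L / r = p₄ at h1 h2 ⊢
        omega

/-- The number of `v ∈ (V₀, V]` in one class modulo `q ≥ 1` is at most `(V − V₀)/q + 2`. -/
theorem card_Ioc_class_le {q V₀ V : ℕ} (hq : 0 < q) (hV : V₀ ≤ V) (c : ZMod q) :
    #((Ioc V₀ V).filter (fun v : ℕ => (v : ZMod q) = c)) ≤ (V - V₀) / q + 2 := by
  refine card_le_of_congruent (a := V₀) (L := V - V₀) hq (fun v hv => ?_) (fun v hv v' hv' => ?_)
  · rw [Finset.mem_filter] at hv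
    rw [Nat.add_sub_cancel' hV]; exact hv.1
  · rw [Finset.mem_filter] at hv hv'
    have : (v : ZMod q) = (v' : ZMod q) := hv.2.trans hv'.2.symm
    exact (ZMod.natCast_eq_natCast_iff' _ _ _).mp this

/-- Changing the height: for `V₀ ≤ V`,
`|∑_{v ≤ V, v ≡ c (q)} λ(v) − ∑_{v ≤ V₀, v ≡ c (q)} λ(v)| ≤ (V − V₀)/q + 2`. -/
theorem abs_classSum_sub_le {q V₀ V : ℕ} (hq : 0 < q) (hV : V₀ ≤ V) (c : ZMod q) :
    |(∑ v ∈ (Icc 1 V).filter (fun v : ℕ => (v : ZMod q) = c), (liouville v : ℝ)) -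
      ∑ v ∈ (Icc 1 V₀).filter (fun v : ℕ => (v : ZMod q) = c), (liouville v : ℝ)| ≤
      (((V - V₀) / q + 2 : ℕ) : ℝ) := by
  classical
  have hsplit : Icc 1 V = Icc 1 V₀ ∪ Ioc V₀ V := by
    ext v; simp only [Finset.mem_union, Finset.mem_Icc, Finset.mem_Ioc]; omega
  have hdisj : Disjoint ((Icc 1 V₀).filter (fun v : ℕ => (v : ZMod q) = c))
      ((Ioc V₀ V).filter (fun v : ℕ => (v : ZMod q) = c)) := by
    rw [Finset.disjoint_left]; intro v hv1 hv2
    rw [Finset.mem_filter, Finset.mem_Icc] at hv1; rw [Finset.mem_filter, Finset.mem_Ioc] at hv2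
    omega
  rw [hsplit, Finset.filter_union, Finset.sum_union hdisj, add_sub_cancel_left]
  refine (Finset.abs_sum_le_sum_abs _ _).trans ?_
  calc ∑ v ∈ (Ioc V₀ V).filter (fun v : ℕ => (v : ZMod q) = c), |(liouville v : ℝ)|
      ≤ ∑ v ∈ (Ioc V₀ V).filter (fun v : ℕ => (v : ZMod q) = c), (1 : ℝ) :=
        Finset.sum_le_sum fun v _ =>
          Literature.NumberTheory.LFunctions.LiouvilleSum.abs_liouville_le_one v
    _ = #((Ioc V₀ V).filter (fun v : ℕ => (v : ZMod q) = c)) := by simp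
    _ ≤ (((V - V₀) / q + 2 : ℕ) : ℝ) := by exact_mod_cast card_Ioc_class_le hq hV c

/-- An odd `l` with `r ∣ d·l − 2` (`r` odd) is coprime to `r` (in `ℤ`). -/
theorem isCoprime_of_switch_residue' {d r l : ℕ} (hr : Odd r)
    (hlr : (r : ℤ) ∣ (d : ℤ) * l - 2) : IsCoprime (r : ℤ) (l : ℤ) := by
  rw [Int.isCoprime_iff_gcd_eq_one, Int.gcd_natCast_natCast]
  by_contra hne
  obtain ⟨p, hp, hpr, hpl⟩ := Nat.Prime.not_coprime_iff_dvd.mp hne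
  have h1 : (p : ℤ) ∣ (d : ℤ) * l - 2 := (Int.natCast_dvd_natCast.mpr hpr).trans hlr
  have h2 : (p : ℤ) ∣ (d : ℤ) * l := (Int.natCast_dvd_natCast.mpr hpl).mul_left _
  have h3 : (p : ℤ) ∣ 2 := by have := h2.sub h1; simpa using this
  have hp2 : p ∣ 2 := by exact_mod_cast h3
  have hp2' : p = 2 := (Nat.prime_dvd_prime_iff_eq hp Nat.prime_two).mp hp2
  subst hp2'
  exact hr.not_two_dvd_nat hpr

/-- **Grouping a piece by classes.**  For `r` odd, `P ⊂ (D', D'+L]`, and a residue selector `g`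
with `g d` odd and `r ∣ d·g(d) − 2` for `d ∈ P`: the `d ∈ P` whose classes `g d (mod 2r)` agree
are congruent modulo `r`, so
`∑_{d ∈ P} |∑_{v ≤ V₀, v ≡ g d (2r)} λ(v)| ≤ (L/r + 2) ∑_{l < 2r, (l,2r)=1} |∑_{v ≤ V₀, v ≡ l (2r)} λ(v)|`. -/
theorem sum_piece_classes_le {r D' L V₀ : ℕ} (hr : Odd r) {P : Finset ℕ}
    (hP : P ⊆ Ioc D' (D' + L)) (g : ℕ → ℕ)
    (hg : ∀ d ∈ P, Odd (g d) ∧ (r : ℤ) ∣ (d : ℤ) * (g d) - 2) :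
    ∑ d ∈ P, |∑ v ∈ (Icc 1 V₀).filter (fun v : ℕ => (v : ZMod (2 * r)) = ((g d : ℕ) : ZMod (2 * r))),
        (liouville v : ℝ)| ≤
      ((L / r + 2 : ℕ) : ℝ) * ∑ l ∈ (range (2 * r)).filter (fun l => l.Coprime (2 * r)),
        |∑ v ∈ (Icc 1 V₀).filter (fun v : ℕ => (v : ZMod (2 * r)) = ((l : ℕ) : ZMod (2 * r))),
          (liouville v : ℝ)| := by
  classical
  have hr0 : 0 < r := hr.pos
  set t := (range (2 * r)).filter (fun l => l.Coprime (2 * r)) with ht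
  set T : ℕ → ℝ := fun l => |∑ v ∈ (Icc 1 V₀).filter
    (fun v : ℕ => (v : ZMod (2 * r)) = ((l : ℕ) : ZMod (2 * r))), (liouville v : ℝ)| with hT
  have hmaps : ∀ d ∈ P, g d % (2 * r) ∈ t := by
    intro d hd
    obtain ⟨hgo, hgr⟩ := hg d hd
    rw [ht, Finset.mem_filter, Finset.mem_range]
    refine ⟨Nat.mod_lt _ (by omega), ?_⟩
    have hcop : Nat.Coprime (g d) (2 * r) := by
      -- odd and coprime to `r`
      have h1 : IsCoprime (r : ℤ) (g d : ℤ) := isCoprime_of_switch_residue' hr hgr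
      rw [Int.isCoprime_iff_gcd_eq_one, Int.gcd_natCast_natCast] at h1
      exact Nat.Coprime.mul_right (Nat.coprime_two_right.mpr hgo) (Nat.coprime_comm.mp h1)
    unfold Nat.Coprime at hcop ⊢
    rwa [← Nat.gcd_comm (2 * r), Nat.gcd_rec] at hcop
  -- group by the value of `g d % 2r`
  have hfib : ∑ d ∈ P, T (g d) = ∑ l ∈ t, ∑ d ∈ P.filter (fun d => g d % (2 * r) = l), T (g d) :=
    (Finset.sum_fiberwise_of_maps_to hmaps _).symm
  change ∑ d ∈ P, T (g d) ≤ ((L / r + 2 : ℕ) : ℝ) * ∑ l ∈ t, T l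
  rw [hfib, Finset.mul_sum]
  refine Finset.sum_le_sum fun l hl => ?_
  have hTeq : ∀ d ∈ P.filter (fun d => g d % (2 * r) = l), T (g d) = T l := by
    intro d hd
    rw [Finset.mem_filter] at hd
    have : ((g d : ℕ) : ZMod (2 * r)) = ((l : ℕ) : ZMod (2 * r)) := by
      rw [← hd.2, ZMod.natCast_mod]
    simp only [hT, this]
  rw [Finset.sum_congr rfl hTeq, Finset.sum_const, nsmul_eq_mul]
  refine mul_le_mul_of_nonneg_right ?_ (by simp only [hT]; exact abs_nonneg _)
  -- the fibre consists of pairwise congruent (mod r) elements of `(D', D'+L]`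
  have hcard : #(P.filter (fun d => g d % (2 * r) = l)) ≤ L / r + 2 := by
    refine card_le_of_congruent hr0 (fun d hd => hP (Finset.mem_filter.mp hd).1) ?_
    intro d hd d' hd'
    rw [Finset.mem_filter] at hd hd'
    obtain ⟨hgo, hgr⟩ := hg d hd.1
    obtain ⟨hgo', hgr'⟩ := hg d' hd'.1
    -- `r ∣ d l - 2` and `r ∣ d' l - 2`
    have h2r : (r : ℤ) ∣ ((2 * r : ℕ) : ℤ) := ⟨2, by push_cast; ring⟩
    have hmod1 : (r : ℤ) ∣ (l : ℤ) - (g d : ℤ) := by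
      have h1 : ((2 * r : ℕ) : ℤ) ∣ (l : ℤ) - (g d : ℤ) :=
        Nat.modEq_iff_dvd.mp ((Nat.mod_modEq (g d) (2 * r)).symm.trans (by rw [hd.2]))
      exact h2r.trans h1
    have hmod2 : (r : ℤ) ∣ (l : ℤ) - (g d' : ℤ) := by
      have h1 : ((2 * r : ℕ) : ℤ) ∣ (l : ℤ) - (g d' : ℤ) :=
        Nat.modEq_iff_dvd.mp ((Nat.mod_modEq (g d') (2 * r)).symm.trans (by rw [hd'.2]))
      exact h2r.trans h1
    have hdl : (r : ℤ) ∣ (d : ℤ) * l - 2 := by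
      have := hgr.add ((hmod1.mul_left (d : ℤ)))
      have e : (d : ℤ) * (g d) - 2 + (d : ℤ) * ((l : ℤ) - (g d : ℤ)) = (d : ℤ) * l - 2 := by ring
      rwa [e] at this
    have hdl' : (r : ℤ) ∣ (d' : ℤ) * l - 2 := by
      have := hgr'.add ((hmod2.mul_left (d' : ℤ)))
      have e : (d' : ℤ) * (g d') - 2 + (d' : ℤ) * ((l : ℤ) - (g d' : ℤ)) = (d' : ℤ) * l - 2 := by ring
      rwa [e] at this
    have hdiff : (r : ℤ) ∣ ((d : ℤ) - d') * l := by
      have := hdl.sub hdl'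
      have e : (d : ℤ) * l - 2 - ((d' : ℤ) * l - 2) = ((d : ℤ) - d') * l := by ring
      rwa [e] at this
    have hcop : IsCoprime (r : ℤ) (l : ℤ) := isCoprime_of_switch_residue' hr hdl
    have hdd : (r : ℤ) ∣ (d : ℤ) - d' := hcop.dvd_of_dvd_mul_right hdiff
    have : d' ≡ d [MOD r] := Nat.modEq_iff_dvd.mpr hdd
    exact this.symm
  exact_mod_cast hcard

/-- Cauchy–Schwarz over the reduced classes: `∑_{l} |T l| ≤ √(2r) · √(∑_l (T l)²)`. -/
theorem sum_abs_classes_le_sqrt {r : ℕ} (T : ℕ → ℝ) :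
    ∑ l ∈ (range (2 * r)).filter (fun l => l.Coprime (2 * r)), |T l| ≤
      Real.sqrt (2 * r) *
        Real.sqrt (∑ l ∈ (range (2 * r)).filter (fun l => l.Coprime (2 * r)), T l ^ 2) := by
  set t := (range (2 * r)).filter (fun l => l.Coprime (2 * r))
  have h := Real.sum_mul_le_sqrt_mul_sqrt t (fun _ => (1 : ℝ)) (fun l => |T l|)
  simp only [one_mul, one_pow, Finset.sum_const, nsmul_eq_mul, mul_one, sq_abs] at h
  refine h.trans (mul_le_mul_of_nonneg_right (Real.sqrt_le_sqrt ?_) (Real.sqrt_nonneg _))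
  have : #t ≤ 2 * r := (Finset.card_filter_le _ _).trans (by simp)
  exact_mod_cast this

/-- `∑_{r ≤ R} 1/r ≤ 1 + log R` (for `R ≥ 1`; the sum is empty for `R = 0`). -/
theorem sum_inv_Icc_le_log (R : ℕ) : ∑ r ∈ Icc 1 R, (1 : ℝ) / r ≤ 1 + Real.log (max R 1) := by
  rcases Nat.eq_zero_or_pos R with rfl | hR
  · simp
  · have h := harmonic_le_one_add_log R
    rw [harmonic_eq_sum_Icc] at h; push_cast at h
    have hm : max (R : ℝ) 1 = R := max_eq_left (by exact_mod_cast hR)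
    rw [hm]
    simpa [one_div] using h

/-- **Cauchy–Schwarz over `r`.**  For nonnegative `B r`:
`∑_{r ≤ R odd} (L/r + 2) √(2r) √(B r) ≤ (2L √(1 + log R) + 4R) √(∑_{r ≤ R odd} B r)`. -/
theorem sum_weights_sqrt_le {R L : ℕ} (B : ℕ → ℝ) (hB : ∀ r, 0 ≤ B r) :
    ∑ r ∈ (Icc 1 R).filter (fun r => Odd r),
        ((L / r + 2 : ℕ) : ℝ) * (Real.sqrt (2 * r) * Real.sqrt (B r)) ≤
      (2 * L * Real.sqrt (1 + Real.log (max R 1)) + 4 * R) *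
        Real.sqrt (∑ r ∈ (Icc 1 R).filter (fun r => Odd r), B r) := by
  set F := (Icc 1 R).filter (fun r => Odd r) with hF
  -- weights `w r = (L/r + 2) √(2r)` with `w r ^ 2 ≤ 4 L²/r + 16 r`
  set w : ℕ → ℝ := fun r => ((L / r + 2 : ℕ) : ℝ) * Real.sqrt (2 * r) with hw
  have hcs := Real.sum_mul_le_sqrt_mul_sqrt F w (fun r => Real.sqrt (B r))
  have hlhs : ∑ r ∈ F, ((L / r + 2 : ℕ) : ℝ) * (Real.sqrt (2 * r) * Real.sqrt (B r)) =
      ∑ r ∈ F, w r * Real.sqrt (B r) := by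
    refine Finset.sum_congr rfl fun r _ => ?_; simp only [hw]; ring
  rw [hlhs]
  refine hcs.trans ?_
  have hB2 : ∑ r ∈ F, Real.sqrt (B r) ^ 2 = ∑ r ∈ F, B r :=
    Finset.sum_congr rfl fun r _ => Real.sq_sqrt (hB r)
  rw [hB2]
  refine mul_le_mul_of_nonneg_right ?_ (Real.sqrt_nonneg _)
  -- `∑ w² ≤ 4L²(1+log R) + 16 R²`
  have hw2 : ∀ r ∈ F, w r ^ 2 ≤ 4 * (L : ℝ) ^ 2 * (1 / r) + 16 * r := by
    intro r hr
    rw [hF, Finset.mem_filter, Finset.mem_Icc] at hr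
    have hr1 : (1 : ℝ) ≤ r := by exact_mod_cast hr.1.1
    have hr0 : (0 : ℝ) < r := by linarith
    simp only [hw]
    rw [mul_pow, Real.sq_sqrt (by positivity)]
    have h1 : ((L / r + 2 : ℕ) : ℝ) ≤ (L : ℝ) / r + 2 := by
      push_cast; gcongr; exact Nat.cast_div_le
    have h2 : ((L / r + 2 : ℕ) : ℝ) ^ 2 ≤ ((L : ℝ) / r + 2) ^ 2 := by gcongr
    have h3 : ((L : ℝ) / r + 2) ^ 2 ≤ 2 * ((L : ℝ) / r) ^ 2 + 2 * 2 ^ 2 := by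
      nlinarith [sq_nonneg ((L : ℝ) / r - 2)]
    calc ((L / r + 2 : ℕ) : ℝ) ^ 2 * (2 * r) ≤ (2 * ((L : ℝ) / r) ^ 2 + 8) * (2 * r) := by
          gcongr; linarith
      _ = 4 * (L : ℝ) ^ 2 * (1 / r) + 16 * r := by field_simp; ring
  have hsumw : ∑ r ∈ F, w r ^ 2 ≤ 4 * (L : ℝ) ^ 2 * (1 + Real.log (max R 1)) + 16 * (R : ℝ) ^ 2 := by
    refine (Finset.sum_le_sum hw2).trans ?_
    rw [Finset.sum_add_distrib, ← Finset.mul_sum, ← Finset.mul_sum]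
    have h1 : ∑ r ∈ F, (1 : ℝ) / r ≤ 1 + Real.log (max R 1) :=
      (Finset.sum_le_sum_of_subset_of_nonneg (Finset.filter_subset _ _)
        fun r _ _ => by positivity).trans (sum_inv_Icc_le_log R)
    have h2 : ∑ r ∈ F, (r : ℝ) ≤ (R : ℝ) ^ 2 := by
      calc ∑ r ∈ F, (r : ℝ) ≤ ∑ r ∈ Icc 1 R, (r : ℝ) :=
            Finset.sum_le_sum_of_subset_of_nonneg (Finset.filter_subset _ _) fun r _ _ => by positivity
        _ ≤ ∑ r ∈ Icc 1 R, (R : ℝ) := Finset.sum_le_sum fun r hr => by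
            rw [Finset.mem_Icc] at hr; exact_mod_cast hr.2
        _ = (R : ℝ) ^ 2 := by simp [sq]
    nlinarith [Real.log_nonneg (le_max_right (R : ℝ) 1)]
  have hlog0 : 0 ≤ Real.log (max (R : ℝ) 1) := Real.log_nonneg (le_max_right _ _)
  calc Real.sqrt (∑ r ∈ F, w r ^ 2)
      ≤ Real.sqrt (4 * (L : ℝ) ^ 2 * (1 + Real.log (max R 1)) + 16 * (R : ℝ) ^ 2) :=
        Real.sqrt_le_sqrt hsumw
    _ ≤ Real.sqrt (4 * (L : ℝ) ^ 2 * (1 + Real.log (max R 1))) + Real.sqrt (16 * (R : ℝ) ^ 2) := by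
        set a := 4 * (L : ℝ) ^ 2 * (1 + Real.log (max R 1))
        set b := 16 * (R : ℝ) ^ 2
        have ha : 0 ≤ a := mul_nonneg (by positivity) (by linarith [hlog0])
        have hb : 0 ≤ b := by positivity
        calc Real.sqrt (a + b) ≤ Real.sqrt ((Real.sqrt a + Real.sqrt b) ^ 2) :=
              Real.sqrt_le_sqrt (by
                nlinarith [Real.sq_sqrt ha, Real.sq_sqrt hb, Real.sqrt_nonneg a, Real.sqrt_nonneg b])
          _ = Real.sqrt a + Real.sqrt b := Real.sqrt_sq (by positivity)
    _ = 2 * L * Real.sqrt (1 + Real.log (max R 1)) + 4 * R := by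
        rw [Real.sqrt_mul' _ (by linarith [hlog0]), show (4 : ℝ) * (L : ℝ) ^ 2 = (2 * L) ^ 2 by ring,
          Real.sqrt_sq (by positivity), show (16 : ℝ) * (R : ℝ) ^ 2 = (4 * R) ^ 2 by ring,
          Real.sqrt_sq (by positivity)]

/-- **The piece estimate.**  Let `P ⊂ (D', D'+L]` be a set of moduli, `g` a residue selector
(`g d r` odd with `r ∣ d·g(d,r) − 2` whenever `r` is odd and `(d,r)=1`), and `Vf` heights with
`V₀ ≤ Vf d r ≤ V₀ + H` on `P × [1,R]`.  Then
`∑_{d ∈ P} ∑_{r ≤ R odd, (d,r)=1} |∑_{v ≤ Vf d r, v ≡ g d r (2r)} λ(v)|`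
`≤ (2L√(1+log R) + 4R) · (∑_{q ≤ 2R} ∑_{l reduced (q)} (∑_{v ≤ V₀, v ≡ l (q)} λ(v))²)^{1/2}`
`+ #P · (H (1 + log R) + 2R)`
[cite: BombieriFriedlanderIwaniecActa1986, Theorem 0; IwaniecKowalski2004, Theorem 17.1]. -/
theorem typeI_piece_le {R D' L V₀ H : ℕ} {P : Finset ℕ} (hP : P ⊆ Ioc D' (D' + L))
    (g : ℕ → ℕ → ℕ)
    (hg : ∀ d ∈ P, ∀ r, Odd r → Nat.Coprime d r → Odd (g d r) ∧ (r : ℤ) ∣ (d : ℤ) * (g d r) - 2)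
    (Vf : ℕ → ℕ → ℕ) (hV : ∀ d ∈ P, ∀ r ∈ Icc 1 R, V₀ ≤ Vf d r ∧ Vf d r ≤ V₀ + H) :
    ∑ d ∈ P, ∑ r ∈ (Icc 1 R).filter (fun r => Odd r ∧ Nat.Coprime d r),
        |∑ v ∈ (Icc 1 (Vf d r)).filter
            (fun v : ℕ => (v : ZMod (2 * r)) = ((g d r : ℕ) : ZMod (2 * r))), (liouville v : ℝ)| ≤
      (2 * L * Real.sqrt (1 + Real.log (max R 1)) + 4 * R) *
          Real.sqrt (∑ q ∈ Icc 1 (2 * R), ∑ l ∈ (range q).filter (fun l => l.Coprime q),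
            (∑ v ∈ (Icc 1 V₀).filter (fun v : ℕ => (v : ZMod q) = ((l : ℕ) : ZMod q)),
              (liouville v : ℝ)) ^ 2) +
        #P * (H * (1 + Real.log (max R 1)) + 2 * R) := by
  classical
  -- notation
  set S : ℕ → ℕ → ℝ := fun d r => ∑ v ∈ (Icc 1 (Vf d r)).filter
    (fun v : ℕ => (v : ZMod (2 * r)) = ((g d r : ℕ) : ZMod (2 * r))), (liouville v : ℝ) with hS
  set S₀ : ℕ → ℕ → ℝ := fun d r => ∑ v ∈ (Icc 1 V₀).filter
    (fun v : ℕ => (v : ZMod (2 * r)) = ((g d r : ℕ) : ZMod (2 * r))), (liouville v : ℝ) with hS₀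
  set T : ℕ → ℕ → ℝ := fun q l => ∑ v ∈ (Icc 1 V₀).filter
    (fun v : ℕ => (v : ZMod q) = ((l : ℕ) : ZMod q)), (liouville v : ℝ) with hT
  set B : ℕ → ℝ := fun r => ∑ l ∈ (range (2 * r)).filter (fun l => l.Coprime (2 * r)),
    T (2 * r) l ^ 2 with hB
  have hlog0 : 0 ≤ Real.log (max (R : ℝ) 1) := Real.log_nonneg (le_max_right _ _)
  have hHR : ∑ r ∈ Icc 1 R, ((H : ℝ) / r + 2) ≤ H * (1 + Real.log (max R 1)) + 2 * R := by
    rw [Finset.sum_add_distrib, Finset.sum_const, Nat.card_Icc, nsmul_eq_mul]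
    have h1 : ∑ r ∈ Icc 1 R, (H : ℝ) / r = H * ∑ r ∈ Icc 1 R, (1 : ℝ) / r := by
      rw [Finset.mul_sum]; refine Finset.sum_congr rfl fun r _ => ?_; ring
    rw [h1]
    have h2 := sum_inv_Icc_le_log R
    have h3 : ((R + 1 - 1 : ℕ) : ℝ) = R := by simp
    rw [h3]
    nlinarith [mul_le_mul_of_nonneg_left h2 (Nat.cast_nonneg H)]
  -- Step 1: replace the heights by `V₀`
  have hstep1 : ∀ d ∈ P, ∑ r ∈ (Icc 1 R).filter (fun r => Odd r ∧ Nat.Coprime d r), |S d r| ≤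
      ∑ r ∈ (Icc 1 R).filter (fun r => Odd r ∧ Nat.Coprime d r), |S₀ d r| +
        (H * (1 + Real.log (max R 1)) + 2 * R) := by
    intro d hd
    have hterm : ∀ r ∈ (Icc 1 R).filter (fun r => Odd r ∧ Nat.Coprime d r),
        |S d r| ≤ |S₀ d r| + ((H : ℝ) / r + 2) := by
      intro r hr
      rw [Finset.mem_filter, Finset.mem_Icc] at hr
      have hr1 : 1 ≤ r := hr.1.1
      obtain ⟨hV1, hV2⟩ := hV d hd r (Finset.mem_Icc.mpr hr.1)
      have hdiff := abs_classSum_sub_le (q := 2 * r) (by omega) hV1 ((g d r : ℕ) : ZMod (2 * r))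
      have hnat : (((Vf d r - V₀) / (2 * r) + 2 : ℕ) : ℝ) ≤ (H : ℝ) / r + 2 := by
        have h1 : (Vf d r - V₀) / (2 * r) ≤ H / r :=
          (Nat.div_le_div_right (by omega)).trans (Nat.div_le_div_left (by omega) (by omega))
        have h2 : (((Vf d r - V₀) / (2 * r) : ℕ) : ℝ) ≤ (H : ℝ) / r :=
          le_trans (by exact_mod_cast h1) Nat.cast_div_le
        push_cast; linarith
      have := abs_sub_abs_le_abs_sub (S d r) (S₀ d r)
      simp only [hS, hS₀] at this hdiff ⊢
      linarith
    refine (Finset.sum_le_sum hterm).trans ?_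
    rw [Finset.sum_add_distrib]
    gcongr
    exact (Finset.sum_le_sum_of_subset_of_nonneg (Finset.filter_subset _ _)
      fun r _ _ => by positivity).trans hHR
  -- Step 2: swap the sums and group each `r` by classes
  have hstep2 : ∑ d ∈ P, ∑ r ∈ (Icc 1 R).filter (fun r => Odd r ∧ Nat.Coprime d r), |S₀ d r| ≤
      ∑ r ∈ (Icc 1 R).filter (fun r => Odd r),
        ((L / r + 2 : ℕ) : ℝ) * (Real.sqrt (2 * r) * Real.sqrt (B r)) := by
    have hswap : ∑ d ∈ P, ∑ r ∈ (Icc 1 R).filter (fun r => Odd r ∧ Nat.Coprime d r), |S₀ d r| =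
        ∑ r ∈ (Icc 1 R).filter (fun r => Odd r),
          ∑ d ∈ P.filter (fun d => Nat.Coprime d r), |S₀ d r| := by
      have h1 : ∀ d ∈ P, ∑ r ∈ (Icc 1 R).filter (fun r => Odd r ∧ Nat.Coprime d r), |S₀ d r| =
          ∑ r ∈ (Icc 1 R).filter (fun r => Odd r),
            if Nat.Coprime d r then |S₀ d r| else 0 := by
        intro d _
        rw [Finset.sum_filter, Finset.sum_filter]
        refine Finset.sum_congr rfl fun r _ => ?_
        by_cases h1 : Odd r <;> by_cases h2 : Nat.Coprime d r <;> simp [h1, h2]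
      rw [Finset.sum_congr rfl h1, Finset.sum_comm]
      refine Finset.sum_congr rfl fun r _ => ?_
      rw [Finset.sum_filter]
    rw [hswap]
    refine Finset.sum_le_sum fun r hr => ?_
    rw [Finset.mem_filter, Finset.mem_Icc] at hr
    have hro : Odd r := hr.2
    have hcl := sum_piece_classes_le (V₀ := V₀) hro (P := P.filter (fun d => Nat.Coprime d r))
      ((Finset.filter_subset _ P).trans hP) (fun d => g d r) (fun d hd => by
        rw [Finset.mem_filter] at hd
        exact hg d hd.1 r hro hd.2)
    refine hcl.trans (mul_le_mul_of_nonneg_left ?_ (by positivity))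
    have := sum_abs_classes_le_sqrt (r := r) (T (2 * r))
    simpa only [hT, hB] using this
  -- Step 3: Cauchy–Schwarz over `r` and comparison with the BDH sum
  have hB0 : ∀ r, 0 ≤ B r := fun r => Finset.sum_nonneg fun _ _ => sq_nonneg _
  have hstep3 := sum_weights_sqrt_le (R := R) (L := L) B hB0
  have hBDH : ∑ r ∈ (Icc 1 R).filter (fun r => Odd r), B r ≤
      ∑ q ∈ Icc 1 (2 * R), ∑ l ∈ (range q).filter (fun l => l.Coprime q), T q l ^ 2 := by
    have hinj : Set.InjOn (fun r : ℕ => 2 * r) ((Icc 1 R).filter (fun r => Odd r) : Set ℕ) :=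
      fun a _ b _ h => by simpa using h
    have heq : ∑ r ∈ (Icc 1 R).filter (fun r => Odd r), B r =
        ∑ q ∈ ((Icc 1 R).filter (fun r => Odd r)).image (fun r : ℕ => 2 * r),
          ∑ l ∈ (range q).filter (fun l => l.Coprime q), T q l ^ 2 := by
      rw [Finset.sum_image hinj]
    rw [heq]
    refine Finset.sum_le_sum_of_subset_of_nonneg ?_ fun q _ _ =>
      Finset.sum_nonneg fun _ _ => sq_nonneg _
    intro q hq
    rw [Finset.mem_image] at hq
    obtain ⟨r, hr, rfl⟩ := hq
    rw [Finset.mem_filter, Finset.mem_Icc] at hr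
    rw [Finset.mem_Icc]; omega
  -- assemble
  have hw0 : 0 ≤ 2 * (L : ℝ) * Real.sqrt (1 + Real.log (max R 1)) + 4 * R := by positivity
  calc ∑ d ∈ P, ∑ r ∈ (Icc 1 R).filter (fun r => Odd r ∧ Nat.Coprime d r), |S d r|
      ≤ ∑ d ∈ P, (∑ r ∈ (Icc 1 R).filter (fun r => Odd r ∧ Nat.Coprime d r), |S₀ d r| +
          (H * (1 + Real.log (max R 1)) + 2 * R)) := Finset.sum_le_sum hstep1
    _ = ∑ d ∈ P, ∑ r ∈ (Icc 1 R).filter (fun r => Odd r ∧ Nat.Coprime d r), |S₀ d r| +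
          #P * (H * (1 + Real.log (max R 1)) + 2 * R) := by
        rw [Finset.sum_add_distrib, Finset.sum_const, nsmul_eq_mul]
    _ ≤ (2 * L * Real.sqrt (1 + Real.log (max R 1)) + 4 * R) *
          Real.sqrt (∑ r ∈ (Icc 1 R).filter (fun r => Odd r), B r) +
          #P * (H * (1 + Real.log (max R 1)) + 2 * R) := by
        gcongr; exact hstep2.trans hstep3
    _ ≤ (2 * L * Real.sqrt (1 + Real.log (max R 1)) + 4 * R) *
          Real.sqrt (∑ q ∈ Icc 1 (2 * R), ∑ l ∈ (range q).filter (fun l => l.Coprime q),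
            T q l ^ 2) + #P * (H * (1 + Real.log (max R 1)) + 2 * R) := by
        gcongr

end Summit.Parity.GeneralizedHardyLittlewood.Theorems
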